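import Literature.Computability.QuantumComplexity.CleanXorGadget
import Literature.Computability.QuantumComplexity.CoreDescAbstract
import Literature.Computability.QuantumComplexity.RenumberDesc
import HarnessLib

/-!
# The abstract gate list of the oracle `U_f` block (`CleanXor.circuit`)

Topic `Literature/Computability/QuantumComplexity`; a companion of `CleanXorGadget.lean` (the exact,
garbage-free Clifford+`T` circuit `CleanXor.circuit G` of `|x⟩|y⟩ ↦ |x⟩|y ⊕ f(x)⟩` for a polynomial-time
`f`: Bennett's clean block `RevClean.cleanOps e M n₀ v` placed behind scattered data wires
(`CleanPlaced.placedOps`, re-indexing `CleanPlaced.relabel n₀ dpos base`), an XOR layer, and the placed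
block reversed) for UNIFORMITY proofs in the abstract-gate-list style of `CoreDescAbstract.lean`
(`AJLCore.toAG`, `AJLCore.progA`, `AJLCore.map_toAG_revCompile_toRevList`): a circuit family is uniform as
soon as the abstract gate lists of its circuits are computed on codes (`CoreDescUniform.lean`). We prove:

* `RevClean.cleanOps_eq_notsV_append` — the clean block with a constant suffix `v` is the suffix layer
  `notsV n₀ v`, the clean block with EMPTY suffix on `n₀ + |v|` data wires, and the suffix layer again
  (so the polynomial-time printers of `CleanBlockDesc.lean` / `ShiftedCleanBlockDesc.lean`, which take
  an empty or run-structured suffix, cover arbitrary parameter suffixes such as `CleanBlockInput.suffix`);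
* `RevSim.ClOp.map_mod_eq_self`, `CleanPlaced.map_val_placedOps` — under the geometry hypotheses the
  wire values of the placed block are those of `cleanOps` re-indexed by `relabel` (no reduction mod `N`);
* `CleanPlaced.relabel_eq_wmap` — `relabel n₀ dpos base` is the table-and-offset wire map
  `RenumDesc.wmap [dpos 0, …, dpos (n₀-1)] base` of `RenumberDesc.lean` (whose string-level renumbering
  `RenumDesc.renumF` is polynomial time);
* `CleanXor.xorOpsN`, `CleanXor.map_val_xorOps` — the XOR layer with `ℕ`-valued wires;
* `AJLCore.progA_map`, `AJLCore.progA_append`, `AJLCore.progA_reverse_map` — bookkeeping of abstract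
  compiled words;
* **`CleanXor.map_toAG_circuit`** — the abstract gate list of `CleanXor.circuit G` is
  `progA (P ++ (X ++ P.reverse))` with `P = (cleanOps e M n₀ v).map (ClOp.map (relabel n₀ dpos base))`
  and `X = xorOpsN …`; with `progA_map`, `P`'s word is the word of `cleanOps` with every wire sent
  through `relabel`.

Everything is proved; no named fact is introduced. (Used by the uniformity of the classical stage of
Regev's sampler, `RegevSamplerClassical.circY/circS/circX = CleanXor.circuit …`.)

## References

* S. Arora, B. Barak, *Computational Complexity: A Modern Approach*, CUP 2009, §6.1–6.2, proof of
  Thm. 6.15 and Remark 6.7 [AroraBarak2009].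
* C. H. Bennett, IBM J. Res. Develop. 17 (1973), §2 [Bennett1973].
* M. A. Nielsen, I. L. Chuang, *Quantum Computation and Quantum Information*, CUP 2010, §3.2.5
  [NielsenChuang2010].
-/

noncomputable section

namespace Literature.Computability.QuantumComplexity

open _root_.Computability Complexity Turing RevSim RevClean RevDesc ClassicalWrap

/-! ### The clean block with a constant suffix -/

namespace RevClean

variable (e : ℕ) (M : TM2ComputableAux Bool Bool)

/-- The suffix layer of an empty suffix is empty. [folklore] -/
theorem notsV_nil_eq (n₀ : ℕ) : notsV n₀ ([] : List Bool) = [] := by simp [notsV]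

/-- **The clean block with suffix `v` is `notsV ++ (the clean block with empty suffix on `n₀ + |v|`
data wires) ++ notsV`.** [cite: Shor1997, §3 p.8] -/
theorem cleanOps_eq_notsV_append (n₀ : ℕ) (v : List Bool) :
    cleanOps e M n₀ v = notsV n₀ v ++ (cleanOps e M (n₀ + v.length) [] ++ notsV n₀ v) := by
  rw [cleanOps, cleanOps, notsV_nil_eq, List.nil_append, List.append_nil, List.length_nil, Nat.add_zero]
  simp only [List.append_assoc]

end RevClean

/-! ### Wire values of the placed block -/

namespace RevSim.ClOp

/-- A gate whose wires are below `N` is unchanged by reduction modulo `N`. [folklore] -/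
theorem map_mod_eq_self {N : ℕ} : ∀ (op : ClOp ℕ), (∀ i ∈ wiresOf op, i < N) → op.map (fun v => v % N) = op
  | .not i, h => by
    have hi := h i ((mem_wiresOf _ _).2 (Or.inl rfl))
    simp only [ClOp.map, Nat.mod_eq_of_lt hi]
  | .cnot i j, h => by
    have hi := h i ((mem_wiresOf _ _).2 (Or.inr (by simp [ClOp.controls])))
    have hj := h j ((mem_wiresOf _ _).2 (Or.inl rfl))
    simp only [ClOp.map, Nat.mod_eq_of_lt hi, Nat.mod_eq_of_lt hj]
  | .toffoli a b c, h => by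
    have ha := h a ((mem_wiresOf _ _).2 (Or.inr (by simp [ClOp.controls])))
    have hb := h b ((mem_wiresOf _ _).2 (Or.inr (by simp [ClOp.controls])))
    have hc := h c ((mem_wiresOf _ _).2 (Or.inl rfl))
    simp only [ClOp.map, Nat.mod_eq_of_lt ha, Nat.mod_eq_of_lt hb, Nat.mod_eq_of_lt hc]

end RevSim.ClOp

namespace CleanPlaced

variable {N : ℕ} {hN : 0 < N} {e : ℕ} {M : TM2ComputableAux Bool Bool} {n₀ : ℕ} {v : List Bool} {dpos : ℕ → ℕ} {base : ℕ}

/-- **The wire values of the placed block** are those of `cleanOps` re-indexed by `relabel`. [folklore] -/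
theorem map_val_placedOps (G : GeomOK N e M n₀ v dpos base) :
    (placedOps hN e M n₀ v dpos base).map (ClOp.map Fin.val) = (cleanOps e M n₀ v).map (ClOp.map (relabel n₀ dpos base)) := by
  rw [placedOps, AJLCore.map_val_map_finOf]
  conv_rhs => rw [← List.map_id ((cleanOps e M n₀ v).map (ClOp.map (relabel n₀ dpos base)))]
  exact List.map_congr_left fun op hop => ClOp.map_mod_eq_self op (lt_of_mem_wiresOf_map G op hop)

omit hN in
/-- **The re-indexing is a table-and-offset wire map** (`RenumberDesc.lean`): table `[dpos 0, …, dpos (n₀-1)]`,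
offset `base`. [folklore] -/
theorem relabel_eq_wmap (n₀ : ℕ) (dpos : ℕ → ℕ) (base : ℕ) :
    relabel n₀ dpos base = RenumDesc.wmap ((List.range n₀).map dpos) base := by
  funext w
  unfold relabel RenumDesc.wmap
  simp only [List.length_map, List.length_range]
  split_ifs with h
  · rw [List.getD_eq_getElem?_getD, List.getElem?_map, List.getElem?_range h]; rfl
  · rfl

end CleanPlaced

/-! ### Abstract compiled words: bookkeeping -/

namespace AJLCore

/-- Re-indexing a program re-indexes its abstract word. [folklore] -/
theorem progA_map (f : ℕ → ℕ) (ops : List (ClOp ℕ)) : progA (ops.map (ClOp.map f)) = (progA ops).map (AGmap f) := by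
  show _ = (progA ops).map (AGate.map f)
  simp only [progA, List.flatMap_map, List.map_flatMap, agates_map]

/-- Abstract words of concatenations. [folklore] -/
theorem progA_append (ops ops' : List (ClOp ℕ)) : progA (ops ++ ops') = progA ops ++ progA ops' := by
  simp only [progA, List.flatMap_append]

end AJLCore

/-! ### The XOR layer and the whole block -/

namespace CleanXor

open AJLCore CleanPlaced

section Defs

variable (e : ℕ) (M : TM2ComputableAux Bool Bool) (n₀ : ℕ) (v : List Bool) (base : ℕ) (m : ℕ) (tpos : ℕ → ℕ)

/-- **The XOR layer with `ℕ`-valued wires**: output bit `j < m` — the result wires (inside the work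
window) of the codes of cell `j` whose symbol is the letter `true` — onto `tpos j`.
[cite: NielsenChuang2010, §3.2.5] -/
def xorOpsN : List (ClOp ℕ) :=
  (List.range m).flatMap fun j => (trueCodes M).map fun a => ClOp.cnot (base + (resW e M (n₀ + v.length) j a - n₀)) (tpos j)

end Defs

variable {N : ℕ} {hN : 0 < N} {e : ℕ} {M : TM2ComputableAux Bool Bool} {n₀ : ℕ} {v : List Bool}
  {dpos : ℕ → ℕ} {base : ℕ} {m : ℕ} {tpos : ℕ → ℕ} (G : GeomOK N e M n₀ v dpos base m tpos)
include G

/-- **The wire values of the XOR layer.** [folklore] -/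
theorem map_val_xorOps : (xorOps hN e M n₀ v base m tpos).map (ClOp.map Fin.val) = xorOpsN e M n₀ v base m tpos := by
  rw [xorOps, xorLayer, List.map_flatMap, xorOpsN]
  refine List.flatMap_congr fun j hj => ?_
  have hjm := List.mem_range.1 hj
  rw [xorInto_eq_map, List.map_map, srcs, List.map_map]
  refine List.map_congr_left fun a _ => ?_
  show ClOp.cnot ((finOf N hN (base + (resW e M (n₀ + v.length) j a - n₀)) : Fin N) : ℕ) ((tgt hN tpos j : Fin N) : ℕ) = _
  rw [val_tgt G hjm, val_finOf_of_lt hN ((srcs_window G hjm a).2.trans_le G.top_le)]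

/-- **The abstract gate list of the oracle block**: the relabelled clean block, the XOR layer, the
relabelled clean block reversed. [cite: NielsenChuang2010, §3.2.5 eq. (3.7)] -/
theorem map_toAG_circuit : (circuit G (hN := hN)).gates.map toAG =
    progA ((cleanOps e M n₀ v).map (ClOp.map (relabel n₀ dpos base)) ++ (xorOpsN e M n₀ v base m tpos ++
      ((cleanOps e M n₀ v).map (ClOp.map (relabel n₀ dpos base))).reverse)) := by
  show (revCompile (toRevList (ops hN e M n₀ v dpos base m tpos) _)).map toAG = _
  rw [map_toAG_revCompile_toRevList, ops, List.map_append, List.map_append, List.map_reverse, map_val_placedOps G.toGeomOK,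
    map_val_xorOps G]

/-- The same, as three abstract words, the outer two being the word of `cleanOps` with every wire sent
through `relabel` (forward, and reversed as a PROGRAM — note `progA` of a reversed program is not the
reversed word). [folklore] -/
theorem map_toAG_circuit' : (circuit G (hN := hN)).gates.map toAG =
    (progA (cleanOps e M n₀ v)).map (AGmap (relabel n₀ dpos base)) ++ (progA (xorOpsN e M n₀ v base m tpos) ++
      (progA (cleanOps e M n₀ v).reverse).map (AGmap (relabel n₀ dpos base))) := by
  rw [map_toAG_circuit G, progA_append, progA_append, ← List.map_reverse, progA_map, progA_map]

end CleanXor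

end Literature.Computability.QuantumComplexity

end
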